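import Summits.BirchSwinnertonDyer.Rank2.LevelFifteenEisensteinLaw
import Summits.BirchSwinnertonDyer.BirchSwinnertonDyer.Theorems.EisensteinDepletionAtTwoStarDefs
import Summits.BirchSwinnertonDyer.BirchSwinnertonDyer.Theorems.EisensteinDepletionAtTwoStarCuspValues
import HarnessLib

/-!
# Route `EisensteinDepletionAtTwo`, crux E1M `DepletedLambdaLawAtTwoMod` (stmt-BirchSwinnertonDyer-20341), line `star`:
# the research stub (★-SymbC) HOLDS AT LEVEL 15 — the symbol half of (★) for `W = 15A8 = [1,1,1,0,0]` is a THEOREM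

Cell `bsd-rank2` (HOME run/shared/lean/pub/bsd-rank2/), seat `bsd-rank2-eng` GEN 10 (helper `--supports` the crux item;
the registered stub `stub_starSymbC` of `Cruxes/DepletedLambdaLawAtTwoMod/Lines/star.lean` quantifies over ALL habitat curves
and is NOT closed by this). For every newform `f` of `15A8` and the admissible stabilisation datum `β = (β₃, β₅) = (3, 1)`:

* **`sameOnC_refFifteen`** — `SameOnCModTwo (plusCuspDiff f) (stabEisCuspDiff 15 β)` unfolded: with `g = s = ±1` and
  `g' = 8/15`, for every `(m, a) ∈ C` the curve side `[a/2^m]⁺_f − [1/2^m]⁺_f = n·g` and the Eisenstein side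
  `v(m, a) = φ_β(γ_{a,2^m}) − φ_β(γ_{1,2^m}) = n'·g'` with `n ≡ n' (mod 2)`, and `n` is odd at `(m, a) = (3, 5)`;
* **`starSymbC_refFifteen`** — the `∃ β` form, literally the body of `StarSymbC` at `W = [1,1,1,0,0]`
  (`W.conductorNorm ℤ = 15`), in the shape consumed by the lead's glue `star_glueFin` / eng-2's
  `sq_X_mul_red_pfree_eq_of_smoothedCongruence`.

MECHANISM (all level-15 arithmetic, parts III/VIII/IX/X of the `Rank2/LevelFifteen*` series): the curve side is
`s·(n₁(k_a) − n₁(k_1))/2` with `n₁` the `E₁`-coordinate of the exact Manin descent at the matrices `k_a = (a, −x; 2^m, 15y)`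
(`ratPlusSymbol_refFifteen_exact`), even by the parity law (`descent_fst_parity_of_fifteen_dvd`: the parity depends on
`c = 2^m` only); the Eisenstein side is `φ(k_a S⁻¹) − φ(k_1 S⁻¹)` for the SAME matrices (`k_a S⁻¹ = γ_{a,2^m}` is the tree's
Bézout matrix); and the EISENSTEIN PERIOD LAW `(15/4)·φ ≡ n₁ + ψ (mod 4)` (`law_pair`, the level-15 congruence character `ψ`
cancelling in the difference) gives `(15/4)·v ≡ n₁(k_a) − n₁(k_1) (mod 4)`, i.e. `15v/8 ≡ (n₁(k_a) − n₁(k_1))/2 (mod 2)`.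

THEOREMS ONLY; no `sorry`; standard axioms. PARTITION: none — r_an ≥ 2, summit axis S0 (D-0036(1)); TWIN (D-0056): n/a.
B1 honesty: finite modular-symbol / Dedekind-sum arithmetic at level 15; nothing reads an analytic rank; no S0 motion;
(★-SymbC) for a general habitat curve, (★), E1M and BSD are NOT proved by this.

References: B. Mazur, J. Tate, J. Teitelbaum, *Invent. Math.* 84 (1986) §I.10 [MazurTateTeitelbaum1986Invent];
G. Stevens, *Arithmetic on Modular Curves*, Progr. Math. 20 (1982) §2.4–2.5 [Stevens1982]; H. Rademacher, E. Grosswald,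
*Dedekind Sums* (1972) Ch. 4 A [RademacherGrosswald1972]; Ju. I. Manin, *Izv. AN SSSR* 36 (1972) Thm. 1.6 [Manin1972];
J. E. Cremona, *Algorithms for modular elliptic curves* (1997) §2.2–§2.8, Table 1 (15A) [CremonaAlgorithms1997].
-/

set_option linter.dupNamespace false

noncomputable section

open scoped MatrixGroups ModularForm

open CongruenceSubgroup Matrix.SpecialLinearGroup ModularGroup
open Literature.NumberTheory.ModularForms Literature.NumberTheory.EllipticCurves
  Literature.NumberTheory.EllipticCurves.ModularForms
open Summit.BirchSwinnertonDyer.Rank2.LevelFifteen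

namespace Summit.BirchSwinnertonDyer.BirchSwinnertonDyer.Theorems.DepletionAtTwo

/-! ## §1 The datum `β = (3, 1)` at level `15`: admissibility and the period function -/

/-- **`β = (3, 1)` is an admissible stabilisation datum at level `15`** (`β₃ = 3 = ℓ`, `β₅ = 1`: mixed signs).
[cite: Stevens1982, §2.4–2.5 (PDF pp. 35–38)] -/
theorem isAdmissibleStabData_fifteen (β : ℕ → ℕ) (h3 : β 3 = 3) (h5 : β 5 = 1) : IsAdmissibleStabData 15 β := by
  have h15 : Nat.primeFactors 15 = {3, 5} := by decide +kernel
  have n3 : (15 : ℕ).factorization 3 = 1 := by decide +kernel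
  have n5 : (15 : ℕ).factorization 5 = 1 := by decide +kernel
  refine ⟨fun ℓ hℓ ↦ ?_, fun ℓ hℓ _ ↦ ?_, Or.inr ⟨⟨3, by rw [h15]; decide, h3⟩, ⟨5, by rw [h15]; decide, h5⟩⟩⟩
  · rw [h15, Finset.mem_insert, Finset.mem_singleton] at hℓ
    rcases hℓ with rfl | rfl
    · rw [n3]; norm_num
    · rw [n5]; norm_num
  · rw [h15, Finset.mem_insert, Finset.mem_singleton] at hℓ
    rcases hℓ with rfl | rfl
    · exact Or.inr h3
    · exact Or.inl h5

/-- The four stabilisation coefficients at level `15` for `β = (3,1)`: `c₁ = 1`, `c₃ = −1`, `c₅ = −1/5`, `c₁₅ = 1/5`.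
[cite: Stevens1982, §2.4 (PDF pp. 35–37)] -/
theorem stabCoeff_fifteen (β : ℕ → ℕ) (h3 : β 3 = 3) (h5 : β 5 = 1) :
    stabCoeff 15 β 1 = 1 ∧ stabCoeff 15 β 3 = -1 ∧ stabCoeff 15 β 5 = -1 / 5 ∧ stabCoeff 15 β 15 = 1 / 5 := by
  have h15 : Nat.primeFactors 15 = {3, 5} := by decide +kernel
  have n3 : (15 : ℕ).factorization 3 = 1 := by decide +kernel
  have n5 : (15 : ℕ).factorization 5 = 1 := by decide +kernel
  have f13 : (1 : ℕ).factorization 3 = 0 := by decide +kernel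
  have f15 : (1 : ℕ).factorization 5 = 0 := by decide +kernel
  have f33 : (3 : ℕ).factorization 3 = 1 := by decide +kernel
  have f35 : (3 : ℕ).factorization 5 = 0 := by decide +kernel
  have f53 : (5 : ℕ).factorization 3 = 0 := by decide +kernel
  have f55 : (5 : ℕ).factorization 5 = 1 := by decide +kernel
  have f153 : (15 : ℕ).factorization 3 = 1 := n3
  have f155 : (15 : ℕ).factorization 5 = 1 := n5
  unfold stabCoeff
  rw [h15, Finset.prod_insert (by decide), Finset.prod_singleton, Finset.prod_insert (by decide), Finset.prod_singleton,
    Finset.prod_insert (by decide), Finset.prod_singleton, Finset.prod_insert (by decide), Finset.prod_singleton]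
  simp only [localStabCoeff, n3, n5, f13, f15, f33, f35, f53, f55, h3, h5, if_true]
  norm_num

/-- **At level `15` with `β = (3,1)` the tree's period function IS part IX's `eisPeriod15`**:
`∑_{t ∣ 15} c_t Φ(a, tb; c/t, d) = Ψ₃ + (1/5)Ψ₅ − (1/5)Ψ₁₅` (`∑ c_t = 0` absorbs `Φ` itself).
[cite: Stevens1982, §2.5 (PDF p. 38)] [cite: RademacherGrosswald1972, Ch. 4 A, eq. (59)–(60)] -/
theorem stabEisensteinPeriod_fifteen_eq (β : ℕ → ℕ) (h3 : β 3 = 3) (h5 : β 5 = 1) (a b c d : ℤ) :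
    stabEisensteinPeriod 15 β a b c d = eisPeriod15 a b c d := by
  obtain ⟨c1, c3, c5, c15⟩ := stabCoeff_fifteen β h3 h5
  have hdiv : Nat.divisors 15 = {1, 3, 5, 15} := by decide
  rw [stabEisensteinPeriod_eq, hdiv, Finset.sum_insert (by decide), Finset.sum_insert (by decide),
    Finset.sum_insert (by decide), Finset.sum_singleton, c1, c3, c5, c15]
  simp only [eisPeriod15, eisensteinPsi]
  push_cast
  simp only [one_mul, Int.ediv_one]
  ring

/-! ## §2 (★-SymbC) at level 15 -/

/-- The symbol-side matrix `k = (a, −x; c, 15y)` of a cusp `a/c` with `c·x + 15a·y = 1`, as an element of `SL(2, ℤ)`;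
`k·S⁻¹ = (x, a; −15y, c)` is the Bézout matrix `γ_{a,c}` of the Eisenstein side. [cite: Stevens1982, §2.5 eq. (2.5.3) (PDF p. 38)] -/
theorem exists_sl_of_bezout (a x c y : ℤ) (h : c * x + a * 15 * y = 1) :
    ∃ k : SL(2, ℤ), k 0 0 = a ∧ k 0 1 = -x ∧ k 1 0 = c ∧ k 1 1 = 15 * y ∧
      (k * S⁻¹) 0 0 = x ∧ (k * S⁻¹) 0 1 = a ∧ (k * S⁻¹) 1 0 = -15 * y ∧ (k * S⁻¹) 1 1 = c := by
  refine ⟨⟨!![a, -x; c, 15 * y], by rw [Matrix.det_fin_two_of]; linear_combination h⟩, rfl, rfl, rfl, rfl, ?_, ?_, ?_, ?_⟩ <;>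
    simp [ModularGroup.S_inv, coe_S]

/-- **(★-SymbC) AT LEVEL 15** (the research stub of line `star`, for the curve `15A8`): for every newform `f` of
`[1,1,1,0,0]` and `β = (3,1)`, with `g = ±1` and `g' = 8/15`: on `C = {(m,a) : m ≥ 3, a ≡ 1 (4), 1 < a < 2^m}`,
`[a/2^m]⁺_f − [1/2^m]⁺_f = n·g`, `φ_β(γ_{a,2^m}) − φ_β(γ_{1,2^m}) = n'·g'`, `n ≡ n' (mod 2)`; and `n` is odd at `(3, 5)`.
[cite: MazurTateTeitelbaum1986Invent, §I.10 (10.1)] [cite: Stevens1982, §2.5 (PDF p. 38)] [cite: Manin1972, Thm. 1.6]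
[cite: CremonaAlgorithms1997, §2.8 and Table 1 (15A)] -/
theorem sameOnC_refFifteen (β : ℕ → ℕ) (h3 : β 3 = 3) (h5 : β 5 = 1) ⦃N : ℕ⦄ [NeZero N]
    (f : CuspForm (Gamma0 N) 2) (hW : IsNewformOf (⟨1, 1, 1, 0, 0⟩ : WeierstrassCurve ℚ) f) :
    ∃ g g' : ℚ, g ≠ 0 ∧ g' ≠ 0 ∧
      (∀ m a, InC m a → ∃ n n' : ℤ, plusCuspDiff f m a = n * g ∧
        stabEisCuspDiff 15 β m a = n' * g' ∧ (n : ZMod 2) = (n' : ZMod 2)) ∧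
      (∃ m a, InC m a ∧ ∃ n : ℤ, plusCuspDiff f m a = n * g ∧ Odd n) := by
  obtain ⟨s, hs, -, hcusp⟩ := ratPlusSymbol_refFifteen_exact f hW
  have hs0 : (s : ℚ) ≠ 0 := by rcases hs with rfl | rfl <;> norm_num
  -- the common computation at a dyadic cusp `a/2^m`, `a` odd
  have key : ∀ (m : ℕ) (a : ℤ), Odd a →
      ∃ w z : ℤ, plusCuspDiff f m a = w * (s : ℚ) ∧ stabEisCuspDiff 15 β m a = (w + 2 * z : ℤ) * (8 / 15 : ℚ) ∧
        2 * w = (descent ((2 ^ m : ℕ) : ℤ) (15 * Int.gcdB ((2 ^ m : ℕ) : ℤ) (a * 15))).1 -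
          (descent ((2 ^ m : ℕ) : ℤ) (15 * Int.gcdB ((2 ^ m : ℕ) : ℤ) 15)).1 := by
    intro m a ha
    set c : ℤ := ((2 ^ m : ℕ) : ℤ) with hc
    have hc0 : c ≠ 0 := by rw [hc]; positivity
    -- Bézout data of `a` and of `1`
    set xa : ℤ := Int.gcdA c (a * 15) with hxa
    set ya : ℤ := Int.gcdB c (a * 15) with hya
    set x1 : ℤ := Int.gcdA c 15 with hx1
    set y1 : ℤ := Int.gcdB c 15 with hy1
    have hga : c * xa + a * 15 * ya = 1 := by
      have h := Int.gcd_eq_gcd_ab c (a * 15)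
      have h1 : Int.gcd c (a * 15) = 1 := by rw [hc]; exact_mod_cast int_gcd_two_pow_eq_one (N := 15) (by decide) ha m
      rw [h1] at h; push_cast at h; linear_combination -h
    have hg1 : c * x1 + 1 * 15 * y1 = 1 := by
      have h := Int.gcd_eq_gcd_ab c 15
      have h1 : Int.gcd c 15 = 1 := by
        have h' := int_gcd_two_pow_eq_one (N := 15) (by decide) odd_one m
        rw [one_mul] at h'; rw [hc]; exact_mod_cast h'
      rw [h1] at h; push_cast at h; linear_combination -h
    obtain ⟨ka, ha00, ha01, ha10, ha11, haS00, haS01, haS10, haS11⟩ := exists_sl_of_bezout a xa c ya hga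
    obtain ⟨k1, h100, h101, h110, h111, h1S00, h1S01, h1S10, h1S11⟩ := exists_sl_of_bezout 1 x1 c y1 hg1
    -- the curve side
    have hua := hcusp a (-xa) c (15 * ya) (by linear_combination hga) hc0 ⟨ya, by ring⟩
    have hu1 := hcusp 1 (-x1) c (15 * y1) (by linear_combination hg1) hc0 ⟨y1, by ring⟩
    -- parity: both `E₁`-coordinates have the parity of `[c ≡ ±2 (mod 5)]`
    have hpa := descent_fst_parity_of_fifteen_dvd (c := c) (d := 15 * ya) ⟨xa, a, by linear_combination hga⟩ ⟨ya, rfl⟩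
    have hp1 := descent_fst_parity_of_fifteen_dvd (c := c) (d := 15 * y1) ⟨x1, 1, by linear_combination hg1⟩ ⟨y1, rfl⟩
    obtain ⟨w, hw⟩ : (2 : ℤ) ∣ (descent c (15 * ya)).1 - (descent c (15 * y1)).1 := by
      have := dvd_sub hpa hp1
      have e : (descent c (15 * ya)).1 - (if c % 5 = 2 ∨ c % 5 = 3 then 1 else 0) -
          ((descent c (15 * y1)).1 - (if c % 5 = 2 ∨ c % 5 = 3 then 1 else 0)) =
          (descent c (15 * ya)).1 - (descent c (15 * y1)).1 := by ring
      rwa [e] at this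
    have hw' : (((descent c (15 * ya)).1 : ℚ)) - ((descent c (15 * y1)).1 : ℚ) = 2 * (w : ℚ) := by
      exact_mod_cast hw
    -- the Eisenstein side: the period law for the pair `(k_a, k_1)`
    obtain ⟨z, hz⟩ := law_pair (k := ka) (k' := k1) (by rw [ha10, h110]) (by rw [ha11]; exact ⟨_, rfl⟩)
      (by rw [h111]; exact ⟨_, rfl⟩)
    rw [ha10, ha11, h110, h111] at hz
    have hv : stabEisCuspDiff 15 β m a = eisPeriod15SL (ka * S⁻¹) - eisPeriod15SL (k1 * S⁻¹) := by
      rw [stabEisCuspDiff_eq, stabEisensteinPeriod_fifteen_eq β h3 h5, stabEisensteinPeriod_fifteen_eq β h3 h5,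
        eisPeriod15SL, eisPeriod15SL, haS00, haS01, haS10, haS11, h1S00, h1S01, h1S10, h1S11]
      simp only [Nat.cast_ofNat, one_mul, ← hc, ← hxa, ← hya, ← hx1, ← hy1]
    refine ⟨w, z, ?_, ?_, by linear_combination -hw⟩
    · -- `u = s·(n₁ − n₁')/2 = w·s`
      unfold plusCuspDiff
      have e1 : ((a : ℚ) / (2 ^ m : ℕ)) = (a : ℚ) / (c : ℚ) := by rw [hc]; push_cast; ring
      have e2 : ((1 : ℚ) / (2 ^ m : ℕ)) = ((1 : ℤ) : ℚ) / (c : ℚ) := by rw [hc]; push_cast; ring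
      rw [e1, e2, hua, hu1]
      push_cast
      linear_combination ((s : ℚ) / 2) * hw'
    · rw [hv]
      push_cast at hz ⊢
      linear_combination (4 / 15 : ℚ) * hz + (4 / 15 : ℚ) * hw'
  refine ⟨s, 8 / 15, hs0, by norm_num, fun m a hma ↦ ?_, ⟨3, 5, ⟨le_rfl, by decide, by norm_num, by norm_num⟩, ?_⟩⟩
  · have ha : Odd a := by
      obtain ⟨-, h4, -, -⟩ := hma
      exact Int.odd_iff.mpr (by omega)
    obtain ⟨w, z, hu, hv, -⟩ := key m a ha
    exact ⟨w, w + 2 * z, hu, hv, by push_cast; rw [show (2 : ZMod 2) = 0 from rfl]; ring⟩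
  · obtain ⟨w, z, hu, -, hw⟩ := key 3 5 (by decide)
    refine ⟨w, hu, ?_⟩
    have d5 : (descent ((2 ^ 3 : ℕ) : ℤ) (15 * Int.gcdB ((2 ^ 3 : ℕ) : ℤ) (5 * 15))).1 = 1 := by decide +kernel
    have d1 : (descent ((2 ^ 3 : ℕ) : ℤ) (15 * Int.gcdB ((2 ^ 3 : ℕ) : ℤ) 15)).1 = -1 := by decide +kernel
    rw [d5, d1] at hw
    exact ⟨0, by omega⟩

/-- **(★-SymbC) AT LEVEL 15, `∃ β` form** — literally the body of the registered research stub `StarSymbC` of line `star`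
at the curve `W = [1,1,1,0,0] = 15A8` (`W.conductorNorm ℤ = 15`), in the shape consumed by the glue `star_glueFin` /
`sq_X_mul_red_pfree_eq_of_smoothedCongruence`: some admissible `β` at level `N_W` has
`plusCuspDiff f ≡ stabEisCuspDiff N_W β` on `C` mod `2` in primitive normalisations, with an odd symbol value.
[cite: MazurTateTeitelbaum1986Invent, §I.10 (10.1)] [cite: Stevens1982, §2.5 (PDF p. 38)] [cite: CremonaAlgorithms1997, §2.8 and Table 1 (15A)] -/
theorem starSymbC_refFifteen ⦃N : ℕ⦄ [NeZero N] (f : CuspForm (Gamma0 N) 2)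
    (hW : IsNewformOf (⟨1, 1, 1, 0, 0⟩ : WeierstrassCurve ℚ) f) :
    ∃ β : ℕ → ℕ, IsAdmissibleStabData ((⟨1, 1, 1, 0, 0⟩ : WeierstrassCurve ℚ).conductorNorm ℤ) β ∧
      ∃ g g' : ℚ, g ≠ 0 ∧ g' ≠ 0 ∧
        (∀ m a, InC m a → ∃ n n' : ℤ, plusCuspDiff f m a = n * g ∧
          stabEisCuspDiff ((⟨1, 1, 1, 0, 0⟩ : WeierstrassCurve ℚ).conductorNorm ℤ) β m a = n' * g' ∧
            (n : ZMod 2) = (n' : ZMod 2)) ∧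
        (∃ m a, InC m a ∧ ∃ n : ℤ, plusCuspDiff f m a = n * g ∧ Odd n) := by
  rw [Summit.BirchSwinnertonDyer.Rank2.refFifteen_conductorNorm]
  exact ⟨fun ℓ ↦ if ℓ = 3 then 3 else 1, isAdmissibleStabData_fifteen _ (by simp) (by simp),
    sameOnC_refFifteen _ (by simp) (by simp) f hW⟩

end Summit.BirchSwinnertonDyer.BirchSwinnertonDyer.Theorems.DepletionAtTwo

end
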